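import Summits.NavierStokesRegularity.NavierStokesRegularity.Theses.AngularGalerkinLadder
import Summits.NavierStokesRegularity.NavierStokesRegularity.Theorems.NoOverheating.Negative.LadderLimitExposed
import Summits.NavierStokesRegularity.NavierStokesRegularity.Theorems.RungBlowupCofinal.NonlinearityLoadBearing
import Literature.Analysis.FluidPDE.TypeIAncientMildClassical
import Literature.Analysis.FluidPDE.PressureReconstruction
import Literature.Analysis.FluidPDE.WholeSpaceIBP
import HarnessLib

/-!
# `NoOverheating` window sequences whose self-advection becomes WEAKLY IRROTATIONAL are excluded
# (route `AngularGalerkinLadder`, crux K2 `NoOverheating`; Negative lane, theorems only)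

Cell `ns-blowup`, seat `ns-blowup-circuit` (g12, AGL Lean seat): a census stratum for the crux
`NoOverheating` (stmt-NavierStokesRegularity-19960) grown from the circuit seat's ancient STOKES
Liouville theorem (`AncientStokesLiouville.eq_zero_of_classicalStokes_typeI`, p562145) and the
«band-visible self-advection is load-bearing» file (`NonlinearityLoadBearing`).

## Statements

* **Profile level** (`no_windowProfile_convect_coband`): no window profile (`IsWindowProfile`,
  `δ > 0`) has, at every time, a self-advection co-band-limited modulo a smooth gradient — such a
  profile is `≡ 0` (`NonlinearityLoadBearing.rungProfile_eq_zero_of_convect_coband`), against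
  the amplitude floor.
* **Sequence level** (`no_windowSequence_weaklyIrrotationalNonlinearity`): there is NO admissible
  window sequence (`1 < c_min`, `0 < δ`, `ε_n → 0`) along which the self-advection becomes weakly a
  gradient: `∫ ⟪(u_n(t)·∇)u_n(t), φ⟫ → 0` for every `t < 0` and every smooth compactly supported
  divergence-free `φ`. Proof: the Type-I ladder limit `v` (`exists_ladderLimit_typeI`: pointwise
  limit, Type-I bound `C₀/√(−t)`, amplitude floor, KNSS-gauge class `IsTypeIAncientMild`) inherits
  `∫ ⟪(v·∇)v, φ⟫ = 0` for all solenoidal tests (trilinear integration by parts + dominated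
  convergence, `integral_inner_convect_test_eq_zero_of_tendsto`); it is classical on every
  `(t₀, 0)` (`IsTypeIAncientMild.exists_isClassicalNSSolutionOn_Ioo`), so the tree's pressure
  reconstruction with force `(v·∇)v` makes it a classical solution of the STOKES system on
  `(−∞, 0)` (`exists_classicalStokes_of_convect_orth`), and the ancient Stokes Liouville theorem
  with Type-I decay gives `v ≡ 0`, against the floor `‖v(−1, x₀)‖ ≥ δ`.
* Packaging: `no_exact_windowProfile_irrotationalNonlinearity` (one exact profile whose
  self-advection is `L²`-orthogonal to solenoidal tests at every time), the supply form
  `not_cofinal_and_noOverheating_weaklyIrrotational`, and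
  `rungBlowupCofinal_false_of_noOverheating_weaklyIrrotational`.

Census reading (for the pen, plan lineage / refuter g18): stratum «weakly irrotational Lamb
vector in the limit» — W-clause
`∀ t < 0, ∀ φ (smooth, compact support, div φ = 0), Tendsto (fun n => ∫ ⟪(u_n t·∇)u_n t, φ⟫) atTop (𝓝 0)`
excluded. What escapes: every sequence whose nonlinearity keeps a solenoidal component of definite
size against some test at some time — the generic case.

LABEL: KERNEL (Negative lane). Nothing here asserts a Theses declaration (the supply form NEGATES a
conjunction); no definition, no named fact, no sorry. WHAT THIS IS NOT: not Navier–Stokes evidence —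
no window or profile is constructed; nothing here bears on whether window sequences exist.
References: [cite: KochNadirashviliSereginSverak2009, Lemma 3.1, Lemma 6.1, Prop. 4.1 (arXiv:0709.3599)].
-/

noncomputable section

namespace Summit.NavierStokesRegularity.AngularGalerkinLadderIrrotationalNonlinearityWindowsExcluded

open Set Filter MeasureTheory Topology Function Metric InnerProductSpace
open scoped RealInnerProductSpace Laplacian ContDiff
open Literature.Analysis Literature.Analysis.FluidPDE
open Summit.NavierStokesRegularity.FluidComputer
open Summit.NavierStokesRegularity.NavierStokesRegularity.Theses.AngularGalerkinLadder
open Summit.NavierStokesRegularity.AngularGalerkinLadderLadderLimit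
open Summit.NavierStokesRegularity.AngularGalerkinLadderAncientStokesLiouville
open Summit.NavierStokesRegularity.AngularGalerkinLadderNonlinearityLoadBearing

/-! ## §1 Profile level: rung-invisible nonlinearity contradicts the amplitude floor -/

/-- **No window profile has rung-invisible self-advection.** A window profile (`δ > 0`) whose
self-advection is co-band-limited modulo a smooth gradient at every time does not exist: it would be
`≡ 0` (`rungProfile_eq_zero_of_convect_coband`), against `‖u(−1, x₀)‖ ≥ δ`. [folklore] -/
theorem no_windowProfile_convect_coband {L : ℕ} {C₀ cmin cmax δ ε c : ℝ}
    {R : EuclideanSpace ℝ (Fin 3) ≃ₗᵢ[ℝ] EuclideanSpace ℝ (Fin 3)}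
    {u : ℝ → EuclideanSpace ℝ (Fin 3) → EuclideanSpace ℝ (Fin 3)}
    {p : ℝ → EuclideanSpace ℝ (Fin 3) → ℝ}
    {d : ℝ → EuclideanSpace ℝ (Fin 3) → EuclideanSpace ℝ (Fin 3)}
    (hW : AngularLadder.IsWindowProfile L C₀ cmin cmax δ ε c R u p d) (hδ : 0 < δ)
    (hinv : ∀ t < 0, ∃ q : EuclideanSpace ℝ (Fin 3) → ℝ, ContDiff ℝ ∞ q ∧
      AngularLadder.IsCobandLimited L fun x => convect (u t) (u t) x + gradient q x) : False := by
  obtain ⟨x₀, hx₀⟩ := hW.2.2.2.1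
  have h0 := rungProfile_eq_zero_of_convect_coband hW.1 hinv (-1) (by norm_num) x₀
  rw [h0, norm_zero] at hx₀
  exact absurd hx₀ (not_le.2 hδ)

/-! ## §2 Passing «the self-advection is weakly a gradient» to pointwise limits -/

/-- **Weak irrotationality of the self-advection passes to bounded pointwise limits.** Let `w_n → w`
pointwise with a uniform bound `‖w_n(x)‖ ≤ M`, all fields `C¹` and divergence free, and let `φ` be a
`C¹` compactly supported field. If `∫ ⟪(w_n·∇)w_n, φ⟫ → 0`, then `∫ ⟪(w·∇)w, φ⟫ = 0`: by the
trilinear integration by parts `∫ ⟪(w·∇)w, φ⟫ = −∫ ⟪w, (w·∇)φ⟫` (`div w = 0`) and dominated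
convergence of `⟪w_n, Dφ(w_n)⟫` (bound `M²‖Dφ‖`, compact support). [folklore] -/
theorem integral_inner_convect_test_eq_zero_of_tendsto {M : ℝ}
    {w : ℕ → EuclideanSpace ℝ (Fin 3) → EuclideanSpace ℝ (Fin 3)}
    {v φ : EuclideanSpace ℝ (Fin 3) → EuclideanSpace ℝ (Fin 3)}
    (hw : ∀ n, ContDiff ℝ 1 (w n)) (hwdiv : ∀ n, VectorCalculus.IsDivFree (w n))
    (hwM : ∀ n x, ‖w n x‖ ≤ M) (hv : ContDiff ℝ 1 v) (hvdiv : VectorCalculus.IsDivFree v)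
    (hlim : ∀ x, Tendsto (fun n => w n x) atTop (𝓝 (v x)))
    (hφ : ContDiff ℝ 1 φ) (hφc : HasCompactSupport φ)
    (hzero : Tendsto (fun n => ∫ x, ⟪convect (w n) (w n) x, φ x⟫) atTop (𝓝 0)) :
    ∫ x, ⟪convect v v x, φ x⟫ = 0 := by
  have hM : 0 ≤ M := (norm_nonneg _).trans (hwM 0 0)
  -- trilinear integration by parts for each field
  have ibp : ∀ {z : EuclideanSpace ℝ (Fin 3) → EuclideanSpace ℝ (Fin 3)}, ContDiff ℝ 1 z →
      VectorCalculus.IsDivFree z →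
      ∫ x, ⟪convect z z x, φ x⟫ = -∫ x, ⟪z x, convect z φ x⟫ := by
    intro z hz hzdiv
    have h0 := integral_inner_convect_add_eq_zero hz hz hφ hφc
    have h1 : ∫ x, VectorCalculus.divergence z x * ⟪z x, φ x⟫ = 0 := by simp [hzdiv _]
    linarith
  -- dominated convergence for `∫ ⟪w_n, (w_n·∇)φ⟫`
  have hDφc : Continuous (fderiv ℝ φ) := hφ.continuous_fderiv one_ne_zero
  have hDφs : HasCompactSupport (fderiv ℝ φ) := hφc.fderiv (𝕜 := ℝ)
  have hbound : Integrable (fun x => M * M * ‖fderiv ℝ φ x‖) (volume : Measure _) :=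
    ((hDφc.integrable_of_hasCompactSupport hDφs).norm).const_mul (M * M)
  have hconv : Tendsto (fun n => ∫ x, ⟪w n x, convect (w n) φ x⟫) atTop
      (𝓝 (∫ x, ⟪v x, convect v φ x⟫)) := by
    refine tendsto_integral_filter_of_dominated_convergence (fun x => M * M * ‖fderiv ℝ φ x‖)
      (Eventually.of_forall fun n => ?_) (Eventually.of_forall fun n => Eventually.of_forall
        fun x => ?_) hbound (Eventually.of_forall fun x => ?_)
    · exact ((hw n).continuous.inner (hDφc.clm_apply (hw n).continuous)).aestronglyMeasurable
    · simp only [convect]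
      calc ‖⟪w n x, fderiv ℝ φ x (w n x)⟫‖ ≤ ‖w n x‖ * ‖fderiv ℝ φ x (w n x)‖ :=
            norm_inner_le_norm _ _
        _ ≤ ‖w n x‖ * (‖fderiv ℝ φ x‖ * ‖w n x‖) :=
            mul_le_mul_of_nonneg_left (ContinuousLinearMap.le_opNorm _ _) (norm_nonneg _)
        _ ≤ M * (‖fderiv ℝ φ x‖ * M) :=
            mul_le_mul (hwM n x) (mul_le_mul_of_nonneg_left (hwM n x) (norm_nonneg _))
              (by positivity) hM
        _ = M * M * ‖fderiv ℝ φ x‖ := by ring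
    · simp only [convect]
      exact (hlim x).inner (((fderiv ℝ φ x).continuous.tendsto _).comp (hlim x))
  -- the limit of `∫⟪(w_n·∇)w_n, φ⟫ = −∫⟪w_n, (w_n·∇)φ⟫` is both `0` and `−∫⟪v, (v·∇)φ⟫`
  have hseq : (fun n => ∫ x, ⟪convect (w n) (w n) x, φ x⟫) =
      fun n => -∫ x, ⟪w n x, convect (w n) φ x⟫ := funext fun n => ibp (hw n) (hwdiv n)
  rw [hseq] at hzero
  have hlim2 : Tendsto (fun n => -∫ x, ⟪w n x, convect (w n) φ x⟫) atTop
      (𝓝 (-∫ x, ⟪v x, convect v φ x⟫)) := hconv.neg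
  have heq := tendsto_nhds_unique hzero hlim2
  rw [ibp hv hvdiv, ← heq]

/-! ## §3 A Type-I ancient mild solution with weakly irrotational self-advection is a classical
Stokes solution -/

/-- **Pressure reconstruction for the Stokes system.** A solution `v` of the KNSS-gauge class
`IsTypeIAncientMild C₀ v` whose self-advection is `L²`-orthogonal to every smooth compactly supported
divergence-free field at every `t < 0` is a classical solution on `(−∞, 0)` of Navier–Stokes forced
by its own nonlinearity — i.e. of the STOKES system — for a reconstructed jointly smooth pressure:
`v` is classical on every `(t₀, 0)` (`exists_isClassicalNSSolutionOn_Ioo`), so `∂ₜv + (v·∇)v − Δv`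
is a gradient there and pairs to zero with solenoidal tests; subtracting the hypothesis and
reconstructing the pressure on the open set `(−∞, 0)` (tree
`exists_isClassicalNSSolutionOn_of_forall_integral_inner_eq_zero`). [folklore] -/
theorem exists_classicalStokes_of_convect_orth {C₀ : ℝ}
    {v : ℝ → EuclideanSpace ℝ (Fin 3) → EuclideanSpace ℝ (Fin 3)} (hv : IsTypeIAncientMild C₀ v)
    (horth : ∀ t < 0, ∀ φ : EuclideanSpace ℝ (Fin 3) → EuclideanSpace ℝ (Fin 3),
      ContDiff ℝ ∞ φ → HasCompactSupport φ → VectorCalculus.IsDivFree φ →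
        ∫ x, ⟪convect (v t) (v t) x, φ x⟫ = 0) :
    ∃ q : ℝ → EuclideanSpace ℝ (Fin 3) → ℝ,
      IsClassicalNSSolutionOn (Iio 0) 1 (fun t x => convect (v t) (v t) x) v q := by
  have hS : UniqueDiffOn ℝ (Iio (0 : ℝ)) := uniqueDiffOn_Iio 0
  have hvs : IsSmoothSpaceTimeOn (Iio 0) v := hv.contDiffOn
  have hF : IsSmoothSpaceTimeOn (Iio 0) (fun t x => convect (v t) (v t) x) := hvs.convect hvs hS
  refine exists_isClassicalNSSolutionOn_of_forall_integral_inner_eq_zero isOpen_Iio hvs hF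
    (fun t ht => hv.isDivFree ht) fun t ht φ hφ hφdiv => ?_
  -- classical on `(t − 1, 0)` with some pressure `p₀`
  obtain ⟨p₀, hcl⟩ := hv.exists_isClassicalNSSolutionOn_Ioo (t₀ := t - 1) (by
    have : t < 0 := ht; linarith)
  have htI : t ∈ Ioo (t - 1) 0 := ⟨by linarith, ht⟩
  -- the two time derivatives agree (both sets are open)
  have hderiv : ∀ x, timeDerivWithin (Iio 0) v t x = timeDerivWithin (Ioo (t - 1) 0) v t x := by
    intro x
    rw [timeDerivWithin_apply, timeDerivWithin_apply,
      derivWithin_of_isOpen isOpen_Iio ht, derivWithin_of_isOpen isOpen_Ioo htI]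
  -- the momentum equation on `(t − 1, 0)` makes the Stokes residual `−∇p₀ − (v·∇)v`
  have hres : ∀ x, timeDerivWithin (Iio 0) v t x + convect (v t) (v t) x - (1 : ℝ) • (Δ (v t)) x -
      (fun t x => convect (v t) (v t) x) t x = -gradient (p₀ t) x - convect (v t) (v t) x := by
    intro x
    have hm := hcl.momentum t htI x
    rw [hderiv x]
    simp only [Pi.zero_apply, add_zero] at hm
    rw [hm]
    simp only
    abel
  have hp1 : ContDiff ℝ 1 (p₀ t) := contDiff_infty.1 (hcl.contDiff_pressure htI) 1
  have hφ1 : ContDiff ℝ 1 φ := contDiff_infty.1 hφ.contDiff 1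
  have hvt1 : ContDiff ℝ 1 (v t) := (hv.contDiff_slice ht).of_le (by exact_mod_cast le_top)
  have iP : Integrable (fun x => ⟪gradient (p₀ t) x, φ x⟫) (volume : Measure _) :=
    integrable_inner_of_hasCompactSupport_right (continuous_gradient_of_contDiff hp1)
      hφ.contDiff.continuous hφ.hasCompactSupport
  have iC : Integrable (fun x => ⟪convect (v t) (v t) x, φ x⟫) (volume : Measure _) :=
    integrable_inner_of_hasCompactSupport_right
      ((hvt1.continuous_fderiv one_ne_zero).clm_apply hvt1.continuous)
      hφ.contDiff.continuous hφ.hasCompactSupport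
  have iPn : Integrable (fun x => -⟪gradient (p₀ t) x, φ x⟫) (volume : Measure _) := iP.neg
  simp_rw [hres, inner_sub_left, inner_neg_left]
  rw [integral_sub iPn iC, integral_neg,
    integral_inner_gradient_eq_neg_integral_mul_divergence hp1 hφ1 hφ.hasCompactSupport,
    horth t ht φ hφ.contDiff hφ.hasCompactSupport hφdiv]
  simp [hφdiv _]

/-! ## §4 The exclusion -/

/-- **NO WINDOW SEQUENCE WITH WEAKLY IRROTATIONAL SELF-ADVECTION IN THE LIMIT.** Let
`(u_n, p_n, d_n)` be window profiles (window `(C₀, [c_min, c_max], δ)`, `c_min > 1`, `δ > 0`, defects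
`ε_n → 0`) such that for every `t < 0` and every smooth compactly supported divergence-free `φ`,
`∫ ⟪(u_n(t)·∇)u_n(t), φ⟫ → 0`. Contradiction: the Type-I ladder limit `v` has self-advection
orthogonal to all solenoidal tests (§2), hence solves the STOKES system classically on `(−∞, 0)`
(§3) with the Type-I bound `C₀/(‖x‖ + √−t)`, hence vanishes (ancient Stokes Liouville theorem,
KNSS Lemma 3.1 by duality) — against the floor `‖v(−1, x₀)‖ ≥ δ > 0`.
[cite: KochNadirashviliSereginSverak2009, Lemma 3.1 and Lemma 6.1 (arXiv:0709.3599)] -/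
theorem no_windowSequence_weaklyIrrotationalNonlinearity {C₀ cmin cmax δ : ℝ} {L : ℕ → ℕ}
    {ε c : ℕ → ℝ} {R : ℕ → (EuclideanSpace ℝ (Fin 3) ≃ₗᵢ[ℝ] EuclideanSpace ℝ (Fin 3))}
    {u : ℕ → ℝ → EuclideanSpace ℝ (Fin 3) → EuclideanSpace ℝ (Fin 3)}
    {p : ℕ → ℝ → EuclideanSpace ℝ (Fin 3) → ℝ}
    {d : ℕ → ℝ → EuclideanSpace ℝ (Fin 3) → EuclideanSpace ℝ (Fin 3)}
    (hcmin : 1 < cmin) (hδ : 0 < δ) (hε : Tendsto ε atTop (𝓝 0))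
    (hW : ∀ n, AngularLadder.IsWindowProfile (L n) C₀ cmin cmax δ (ε n) (c n) (R n) (u n) (p n)
      (d n))
    (hirr : ∀ t < 0, ∀ φ : EuclideanSpace ℝ (Fin 3) → EuclideanSpace ℝ (Fin 3),
      ContDiff ℝ ∞ φ → HasCompactSupport φ → VectorCalculus.IsDivFree φ →
        Tendsto (fun n => ∫ x, ⟪convect (u n t) (u n t) x, φ x⟫) atTop (𝓝 0)) : False := by
  obtain ⟨φ, c', R', v, hφ, -, -, -, hptw, -, -, -, hTAM, -, -, hvTI, hamp, -⟩ :=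
    exists_ladderLimit_typeI hcmin hδ hε hW
  have hC₀ : 0 ≤ C₀ := hTAM.nonneg
  -- Step 1: the limit's self-advection is orthogonal to solenoidal tests at every `t < 0`
  have horth : ∀ t < 0, ∀ ψ : EuclideanSpace ℝ (Fin 3) → EuclideanSpace ℝ (Fin 3),
      ContDiff ℝ ∞ ψ → HasCompactSupport ψ → VectorCalculus.IsDivFree ψ →
        ∫ x, ⟪convect (v t) (v t) x, ψ x⟫ = 0 := by
    intro t ht ψ hψ hψc hψdiv
    have hsq : 0 < Real.sqrt (-t) := Real.sqrt_pos.2 (by linarith)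
    have hcl : ∀ n, IsClassicalNSSolutionOn (Iio 0) 1 (d (φ n)) (u (φ n)) (p (φ n)) :=
      fun n => (hW (φ n)).1.classical
    refine integral_inner_convect_test_eq_zero_of_tendsto (M := C₀ / Real.sqrt (-t))
      (w := fun n => u (φ n) t)
      (fun n => ((hcl n).contDiff_velocity (mem_Iio.2 ht)).of_le (by exact_mod_cast le_top))
      (fun n => (hcl n).divFree t ht)
      (fun n y => ((hW (φ n)).1.hasTypeIDecay t ht y).trans
        (div_le_div_of_nonneg_left hC₀ hsq (by linarith [norm_nonneg y])))
      ((hTAM.contDiff_slice ht).of_le (by exact_mod_cast le_top)) (hTAM.isDivFree ht)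
      (hptw t ht) (contDiff_infty.1 hψ 1) hψc ?_
    exact (hirr t ht ψ hψ hψc hψdiv).comp hφ.tendsto_atTop
  -- Step 2: the limit is a classical Stokes solution on `(−∞, 0)`, hence zero
  obtain ⟨q, hcl⟩ := exists_classicalStokes_of_convect_orth hTAM horth
  have hzero := eq_zero_of_classicalStokes_typeI hcl (fun t _ x => rfl) hvTI
  -- Step 3: the amplitude floor
  obtain ⟨x₀, hx₀⟩ := hamp
  rw [hzero (-1) (by norm_num) x₀, norm_zero] at hx₀
  exact absurd hx₀ (not_le.2 hδ)

/-- **One EXACT window profile (defect size `0`) with irrotational-in-`L²` self-advection does not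
exist**: a Type-I rotated-DSS ancient rung profile in a window with `δ > 0` and `HasDefectBound 0`,
whose self-advection is `L²`-orthogonal to every solenoidal test field at every time, is
contradictory (constant sequence in `no_windowSequence_weaklyIrrotationalNonlinearity`). [folklore] -/
theorem no_exact_windowProfile_irrotationalNonlinearity {C₀ cmin cmax δ c₀ : ℝ} {L₀ : ℕ}
    {R₀ : EuclideanSpace ℝ (Fin 3) ≃ₗᵢ[ℝ] EuclideanSpace ℝ (Fin 3)}
    {u₀ : ℝ → EuclideanSpace ℝ (Fin 3) → EuclideanSpace ℝ (Fin 3)}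
    {p₀ : ℝ → EuclideanSpace ℝ (Fin 3) → ℝ}
    {d₀ : ℝ → EuclideanSpace ℝ (Fin 3) → EuclideanSpace ℝ (Fin 3)}
    (hcmin : 1 < cmin) (hδ : 0 < δ)
    (hW : AngularLadder.IsWindowProfile L₀ C₀ cmin cmax δ 0 c₀ R₀ u₀ p₀ d₀)
    (hirr : ∀ t < 0, ∀ φ : EuclideanSpace ℝ (Fin 3) → EuclideanSpace ℝ (Fin 3),
      ContDiff ℝ ∞ φ → HasCompactSupport φ → VectorCalculus.IsDivFree φ →
        ∫ x, ⟪convect (u₀ t) (u₀ t) x, φ x⟫ = 0) : False :=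
  no_windowSequence_weaklyIrrotationalNonlinearity (L := fun _ => L₀) (ε := fun _ => 0)
    (c := fun _ => c₀) (R := fun _ => R₀) (u := fun _ => u₀) (p := fun _ => p₀) (d := fun _ => d₀)
    hcmin hδ tendsto_const_nhds (fun _ => hW) (fun t ht φ hφ hφc hφdiv => by
      simp only [hirr t ht φ hφ hφc hφdiv]; exact tendsto_const_nhds)

/-- **Supply form.** `RungBlowupCofinal` together with a `NoOverheating` supply of windows along
which the self-advection becomes weakly a gradient (for every `t < 0` and every solenoidal test
`φ`, `∫ ⟪(u_L(t)·∇)u_L(t), φ⟫ → 0` as `L → ∞` along the supplied rungs) is contradictory.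
[cite: KochNadirashviliSereginSverak2009, Lemma 3.1 and Lemma 6.1 (arXiv:0709.3599)] -/
theorem not_cofinal_and_noOverheating_weaklyIrrotational (C₀ : ℝ) :
    ¬ (RungBlowupCofinal ∧
      ∃ (cmin cmax δ : ℝ) (L₀ : ℕ) (ε : ℕ → ℝ)
        (u : ℕ → ℝ → EuclideanSpace ℝ (Fin 3) → EuclideanSpace ℝ (Fin 3)),
        1 < cmin ∧ 0 < δ ∧ Tendsto ε atTop (𝓝 0) ∧
        (∀ L ≥ L₀, AngularLadder.RungIsSingular L →
          ∃ (c : ℝ) (R : EuclideanSpace ℝ (Fin 3) ≃ₗᵢ[ℝ] EuclideanSpace ℝ (Fin 3))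
            (p : ℝ → EuclideanSpace ℝ (Fin 3) → ℝ)
            (d : ℝ → EuclideanSpace ℝ (Fin 3) → EuclideanSpace ℝ (Fin 3)),
            AngularLadder.IsWindowProfile L C₀ cmin cmax δ (ε L) c R (u L) p d) ∧
        ∀ t < 0, ∀ φ : EuclideanSpace ℝ (Fin 3) → EuclideanSpace ℝ (Fin 3),
          ContDiff ℝ ∞ φ → HasCompactSupport φ → VectorCalculus.IsDivFree φ →
            Tendsto (fun L => ∫ x, ⟪convect (u L t) (u L t) x, φ x⟫) atTop (𝓝 0)) := by
  rintro ⟨h₁, cmin, cmax, δ, L₀, ε, u, hcmin, hδ, hε, hwin, hirr⟩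
  choose L hLge hLsing using fun n : ℕ => h₁ (max L₀ n)
  choose c R p d hW using fun n : ℕ =>
    hwin (L n) (le_trans (le_max_left _ _) (hLge n)) (hLsing n)
  have hLtop : Tendsto L atTop atTop :=
    tendsto_atTop_mono (fun n => le_trans (le_max_right _ _) (hLge n)) tendsto_id
  have hε' : Tendsto (fun n : ℕ => ε (L n)) atTop (𝓝 0) := hε.comp hLtop
  exact no_windowSequence_weaklyIrrotationalNonlinearity (u := fun n => u (L n)) hcmin hδ hε' hW
    fun t ht φ hφ hφc hφdiv => (hirr t ht φ hφ hφc hφdiv).comp hLtop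

/-- `RungBlowupCofinal` fails as soon as `NoOverheating` is met by windows whose self-advection
becomes weakly a gradient along the rungs (contrapositive packaging of
`not_cofinal_and_noOverheating_weaklyIrrotational`). [folklore] -/
theorem rungBlowupCofinal_false_of_noOverheating_weaklyIrrotational (C₀ : ℝ)
    (h : ∃ (cmin cmax δ : ℝ) (L₀ : ℕ) (ε : ℕ → ℝ)
        (u : ℕ → ℝ → EuclideanSpace ℝ (Fin 3) → EuclideanSpace ℝ (Fin 3)),
        1 < cmin ∧ 0 < δ ∧ Tendsto ε atTop (𝓝 0) ∧
        (∀ L ≥ L₀, AngularLadder.RungIsSingular L →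
          ∃ (c : ℝ) (R : EuclideanSpace ℝ (Fin 3) ≃ₗᵢ[ℝ] EuclideanSpace ℝ (Fin 3))
            (p : ℝ → EuclideanSpace ℝ (Fin 3) → ℝ)
            (d : ℝ → EuclideanSpace ℝ (Fin 3) → EuclideanSpace ℝ (Fin 3)),
            AngularLadder.IsWindowProfile L C₀ cmin cmax δ (ε L) c R (u L) p d) ∧
        ∀ t < 0, ∀ φ : EuclideanSpace ℝ (Fin 3) → EuclideanSpace ℝ (Fin 3),
          ContDiff ℝ ∞ φ → HasCompactSupport φ → VectorCalculus.IsDivFree φ →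
            Tendsto (fun L => ∫ x, ⟪convect (u L t) (u L t) x, φ x⟫) atTop (𝓝 0)) :
    ¬ RungBlowupCofinal := fun h₁ => not_cofinal_and_noOverheating_weaklyIrrotational C₀ ⟨h₁, h⟩

end Summit.NavierStokesRegularity.AngularGalerkinLadderIrrotationalNonlinearityWindowsExcluded

end
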